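import Mathlib
import Summits.KontsevichZagierPeriods.Zeta5Search.Profile18bCellsA
import Summits.KontsevichZagierPeriods.Zeta5Search.Profile18bCellsB
import Summits.KontsevichZagierPeriods.Zeta5Search.DenomLaw.Profile19Path
import HarnessLib

/-!
# ζ(5) search — the `N_p = 18` PROFILE with short blocks `(1,2), (1,3), (2,3)` for EVERY sorted parameter vector: the Lemma-D bonus `−10` (general `b`), PATH accounting below `d = 3p`, (CV) on the whole profile

Cell `pub-zeta5` (HONEST FRAMING: systematic search; no irrationality claim unless certified), TRACK «DENOM-LAW» D1 prover seat
(denom-prover-d1 g17, `HOME/denom-law/prover-d1/ATTEMPT-17.md` §E).  Fourth general-`b` profile of the first period after `DenomLaw/FullProfilePath` (`N_p = 21`),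
`DenomLaw/Profile20Path` (`20`), `DenomLaw/Profile19Path` (`19`).  At `N_p = 18` the third short block of a sorted vector is either `b₀ − b₁ − b₄` or
`b₀ − b₂ − b₃`; this file treats the latter branch: `p ≤ b₇`, `b₀ − b₂ − b₃ < p ≤ b₀ − b₁ − b₄` (inside the first period).  Then `N_p = 18` (`pairFloors_eq_18b`),
`C⋆ ≤ 11`, `p < d < 4p` (`d_bounds18b`), and the node `DenomLaw.PathAccountingFirstPeriod` asks `⌊d/p⌋ − 12`.  PROVED HERE for every sorted `b`: the
machine-generated covers `FullProfile.cover18b_ev / cover18b_od` (`Profile18bCells{A,B}`, 30 / 29 types; least multipole exponent `−7`, realised only by the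
conjugate pair `[1,−6,−3,1]` / `[1,−3,−6,1]`) pass the Lemma-D checks at `m = −7` (`checkLB` at `(−7, −4)`, `checkJ`, fallback `checkLBx` at `(−7; −6, −4)`;
`checkJ18b_ev/od`, `decide`), so `TopFamFP.cover_J_j` gives **`v_p(Cas_j(b)) ≥ −10` on the whole profile** (`cas_ge18b_neg10`, every `j`) — the node's value
for `⌊d/p⌋ ≤ 2`: **`pathAccounting_profile18b`** / **`pathAccountingFirstPeriod_profile18b`** (binders verbatim plus the profile inequalities and `d < 3p`), and
(CV) on the WHOLE profile (`profile18bCV`).  OPEN: `3p ≤ d` (node `−9`; recon `g17/code/profile_recon.py`: 32 of 7,193 instances at `p ≤ 11`, exact `v = −9`,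
no catalogued rung — a `casLB + 2` on the conjugate-pair configuration at `m = −7`); and the OTHER `N_p = 18` branch (third short block `b₀ − b₁ − b₄`), where
1,495 of 3,449 instances need uncatalogued rungs (ATTEMPT-17 §4).  MODEL/structure-side valuation bookkeeping of the cell's own rationals; nothing about
ζ(5); no γ; records in print UNMOVED.
-/

open Finset

namespace Summit.KontsevichZagierPeriods.Zeta5Search.FullProfile

open Summit.KontsevichZagierPeriods.Zeta5Search.ClusterValuation
open Summit.KontsevichZagierPeriods.Zeta5Search.CasoratianValuation (InPolytope shift casoratian pairFloors refund)
open Summit.KontsevichZagierPeriods.Zeta5Search.WedgeDictionary (dOf)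
open Summit.KontsevichZagierPeriods.Zeta5Search.ClassTypeCover
open Summit.KontsevichZagierPeriods.Zeta5Search.DenomLaw (cStar FirstPeriod Sorted7)
open Summit.KontsevichZagierPeriods.Zeta5Search.DenomLaw.FirstPeriodKit (cStar_le_eleven sorted7_chain firstPeriod_pair pairFloors_expand)
open Summit.KontsevichZagierPeriods.Zeta5Search.StairTS3 (refund_le_pathHead)
open Summit.KontsevichZagierPeriods.Zeta5Search.TopFamFP (cover_J_j)
open Summit.KontsevichZagierPeriods.Zeta5Search.SortedProfile

/-! ## §1 The Lemma-D checks on the two covers -/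

/-- THEOREM LB at `(−7, −4)`, `checkJ` at `m = −7`, fallback `checkLBx` at `(−7; −6, −4)` on the `N_p = 18` (branch `(2,3)`) types, `b₀` even. -/
theorem checkJ18b_ev : checkLB false
      [([1, -5, 1], true), ([1, -6, 1], false), ([1, 1, -6, 1], false), ([1, 0, -6, 1], false), ([1, -1, -6, 1], false), ([1, -2, -6, 1], false), ([1, -3, -6, 1], false), ([1, -3, -5, 1], false), ([1, -3, -4, 1], false), ([1, -3, -3, 1], false), ([1, -4, -4, 1], false), ([1, -4, -3, 1], false), ([1, -5, -3, 1], false), ([1, -6, -3, 1], false), ([1, -6, -2, 1], false), ([1, -6, -1, 1], false), ([1, -6, 0, 1], false), ([1, -6, 1, 1], false), ([1, 1, -5, 1, 1], true), ([1, 1, -6, -3, 1], false), ([1, 1, -6, -2, 1], false), ([1, 1, -6, -1, 1], false), ([1, 1, -6, 0, 1], false), ([1, 1, -6, 1, 1], false), ([1, 0, -5, 0, 1], true), ([1, 0, -6, 0, 1], false), ([1, 0, -6, 1, 1], false), ([1, -1, -6, 1, 1], false), ([1, -2, -6, 1, 1], false), ([1, -3, -6, 1, 1], false)]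
      (-7) (-4) = true ∧ checkJ false
      [([1, -5, 1], true), ([1, -6, 1], false), ([1, 1, -6, 1], false), ([1, 0, -6, 1], false), ([1, -1, -6, 1], false), ([1, -2, -6, 1], false), ([1, -3, -6, 1], false), ([1, -3, -5, 1], false), ([1, -3, -4, 1], false), ([1, -3, -3, 1], false), ([1, -4, -4, 1], false), ([1, -4, -3, 1], false), ([1, -5, -3, 1], false), ([1, -6, -3, 1], false), ([1, -6, -2, 1], false), ([1, -6, -1, 1], false), ([1, -6, 0, 1], false), ([1, -6, 1, 1], false), ([1, 1, -5, 1, 1], true), ([1, 1, -6, -3, 1], false), ([1, 1, -6, -2, 1], false), ([1, 1, -6, -1, 1], false), ([1, 1, -6, 0, 1], false), ([1, 1, -6, 1, 1], false), ([1, 0, -5, 0, 1], true), ([1, 0, -6, 0, 1], false), ([1, 0, -6, 1, 1], false), ([1, -1, -6, 1, 1], false), ([1, -2, -6, 1, 1], false), ([1, -3, -6, 1, 1], false)]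
      (-7) = true ∧ checkLBx false
      [([1, -5, 1], true), ([1, -6, 1], false), ([1, 1, -6, 1], false), ([1, 0, -6, 1], false), ([1, -1, -6, 1], false), ([1, -2, -6, 1], false), ([1, -3, -6, 1], false), ([1, -3, -5, 1], false), ([1, -3, -4, 1], false), ([1, -3, -3, 1], false), ([1, -4, -4, 1], false), ([1, -4, -3, 1], false), ([1, -5, -3, 1], false), ([1, -6, -3, 1], false), ([1, -6, -2, 1], false), ([1, -6, -1, 1], false), ([1, -6, 0, 1], false), ([1, -6, 1, 1], false), ([1, 1, -5, 1, 1], true), ([1, 1, -6, -3, 1], false), ([1, 1, -6, -2, 1], false), ([1, 1, -6, -1, 1], false), ([1, 1, -6, 0, 1], false), ([1, 1, -6, 1, 1], false), ([1, 0, -5, 0, 1], true), ([1, 0, -6, 0, 1], false), ([1, 0, -6, 1, 1], false), ([1, -1, -6, 1, 1], false), ([1, -2, -6, 1, 1], false), ([1, -3, -6, 1, 1], false)]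
      (-7) (-6) (-4) = true := by decide

/-- The same checks on the `N_p = 18` (branch `(2,3)`) types, `b₀` odd. -/
theorem checkJ18b_od : checkLB true
      [([1, -6, 1], false), ([1, 1, -6, 1], false), ([1, 0, -6, 1], false), ([1, -1, -6, 1], false), ([1, -2, -6, 1], false), ([1, -3, -6, 1], false), ([1, -3, -5, 1], false), ([1, -3, -4, 1], false), ([1, -3, -3, 1], true), ([1, -3, -3, 1], false), ([1, -4, -4, 1], true), ([1, -4, -4, 1], false), ([1, -4, -3, 1], false), ([1, -5, -3, 1], false), ([1, -6, -3, 1], false), ([1, -6, -2, 1], false), ([1, -6, -1, 1], false), ([1, -6, 0, 1], false), ([1, -6, 1, 1], false), ([1, 1, -6, -3, 1], false), ([1, 1, -6, -2, 1], false), ([1, 1, -6, -1, 1], false), ([1, 1, -6, 0, 1], false), ([1, 1, -6, 1, 1], false), ([1, 0, -6, 0, 1], false), ([1, 0, -6, 1, 1], false), ([1, -1, -6, 1, 1], false), ([1, -2, -6, 1, 1], false), ([1, -3, -6, 1, 1], false)]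
      (-7) (-4) = true ∧ checkJ true
      [([1, -6, 1], false), ([1, 1, -6, 1], false), ([1, 0, -6, 1], false), ([1, -1, -6, 1], false), ([1, -2, -6, 1], false), ([1, -3, -6, 1], false), ([1, -3, -5, 1], false), ([1, -3, -4, 1], false), ([1, -3, -3, 1], true), ([1, -3, -3, 1], false), ([1, -4, -4, 1], true), ([1, -4, -4, 1], false), ([1, -4, -3, 1], false), ([1, -5, -3, 1], false), ([1, -6, -3, 1], false), ([1, -6, -2, 1], false), ([1, -6, -1, 1], false), ([1, -6, 0, 1], false), ([1, -6, 1, 1], false), ([1, 1, -6, -3, 1], false), ([1, 1, -6, -2, 1], false), ([1, 1, -6, -1, 1], false), ([1, 1, -6, 0, 1], false), ([1, 1, -6, 1, 1], false), ([1, 0, -6, 0, 1], false), ([1, 0, -6, 1, 1], false), ([1, -1, -6, 1, 1], false), ([1, -2, -6, 1, 1], false), ([1, -3, -6, 1, 1], false)]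
      (-7) = true ∧ checkLBx true
      [([1, -6, 1], false), ([1, 1, -6, 1], false), ([1, 0, -6, 1], false), ([1, -1, -6, 1], false), ([1, -2, -6, 1], false), ([1, -3, -6, 1], false), ([1, -3, -5, 1], false), ([1, -3, -4, 1], false), ([1, -3, -3, 1], true), ([1, -3, -3, 1], false), ([1, -4, -4, 1], true), ([1, -4, -4, 1], false), ([1, -4, -3, 1], false), ([1, -5, -3, 1], false), ([1, -6, -3, 1], false), ([1, -6, -2, 1], false), ([1, -6, -1, 1], false), ([1, -6, 0, 1], false), ([1, -6, 1, 1], false), ([1, 1, -6, -3, 1], false), ([1, 1, -6, -2, 1], false), ([1, 1, -6, -1, 1], false), ([1, 1, -6, 0, 1], false), ([1, 1, -6, 1, 1], false), ([1, 0, -6, 0, 1], false), ([1, 0, -6, 1, 1], false), ([1, -1, -6, 1, 1], false), ([1, -2, -6, 1, 1], false), ([1, -3, -6, 1, 1], false)]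
      (-7) (-6) (-4) = true := by decide

/-! ## §2 The bound `−10` on the whole profile, every sorted `b`, every `j` -/

section Bounds

variable {b : ℕ → ℤ} {j p : ℕ}

/-- On this profile of the first period `p < d(b) < 4p`. -/
theorem d_bounds18b (hs : Sorted7 b) (hP : (p : ℤ) ≤ b 7) (hQ : b 0 < (p : ℤ) + b 2 + b 3) (hQ4 : (p : ℤ) + b 1 + b 4 ≤ b 0)
    (hF1 : b 1 < 2 * (p : ℤ)) (hF2 : b 0 < 2 * (p : ℤ) + b 6 + b 7) : (p : ℤ) < dOf b ∧ dOf b < 4 * (p : ℤ) := by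
  obtain ⟨h21, h32, h43, h54, h65, h76⟩ := sorted7_chain hs
  rw [DecompositionWholeCone.dOf_expand]; constructor <;> linarith

/-- **`N_p = 18`** on this profile: the three smallest pair digits are `0`, the other eighteen are `1`. -/
theorem pairFloors_eq_18b (hb : InPolytope b) (hs : Sorted7 b) (hp : 0 < p) (hQ : b 0 < (p : ℤ) + b 2 + b 3) (hQ4 : (p : ℤ) + b 1 + b 4 ≤ b 0)
    (hfp : FirstPeriod b p) : pairFloors b p = 18 := by
  obtain ⟨h21, h32, h43, h54, h65, h76⟩ := sorted7_chain hs
  obtain ⟨h0, hb1, hb2, hb3, hb4, -, -, -, hc1⟩ := box hb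
  have hp0 : (0 : ℤ) < p := by exact_mod_cast hp
  have one : ∀ z : ℤ, (p : ℤ) ≤ z → z ≤ 2 * (p : ℤ) - 1 → z / (p : ℤ) = 1 := fun z h1 h2 => by
    rw [Int.ediv_eq_iff_of_pos hp0]; constructor <;> linarith
  have z12 : (b 0 - b 1 - b 2) / (p : ℤ) = 0 := Int.ediv_eq_zero_of_lt (by linarith) (by linarith)
  have z13 : (b 0 - b 1 - b 3) / (p : ℤ) = 0 := Int.ediv_eq_zero_of_lt (by linarith) (by linarith)
  have z23 : (b 0 - b 2 - b 3) / (p : ℤ) = 0 := Int.ediv_eq_zero_of_lt (by linarith) (by linarith)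
  have U := fun (i k : ℕ) (hi : i < 7) (hk : k < 7) (hik : i < k) => firstPeriod_pair hfp hi hk hik
  rw [pairFloors_expand, z12, z13, z23,
    one _ (by linarith) (U 0 3 (by norm_num) (by norm_num) (by norm_num)), one _ (by linarith) (U 0 4 (by norm_num) (by norm_num) (by norm_num)),
    one _ (by linarith) (U 0 5 (by norm_num) (by norm_num) (by norm_num)), one _ (by linarith) (U 0 6 (by norm_num) (by norm_num) (by norm_num)),
    one _ (by linarith) (U 1 3 (by norm_num) (by norm_num) (by norm_num)), one _ (by linarith) (U 1 4 (by norm_num) (by norm_num) (by norm_num)),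
    one _ (by linarith) (U 1 5 (by norm_num) (by norm_num) (by norm_num)), one _ (by linarith) (U 1 6 (by norm_num) (by norm_num) (by norm_num)),
    one _ (by linarith) (U 2 3 (by norm_num) (by norm_num) (by norm_num)), one _ (by linarith) (U 2 4 (by norm_num) (by norm_num) (by norm_num)),
    one _ (by linarith) (U 2 5 (by norm_num) (by norm_num) (by norm_num)), one _ (by linarith) (U 2 6 (by norm_num) (by norm_num) (by norm_num)),
    one _ (by linarith) (U 3 4 (by norm_num) (by norm_num) (by norm_num)), one _ (by linarith) (U 3 5 (by norm_num) (by norm_num) (by norm_num)),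
    one _ (by linarith) (U 3 6 (by norm_num) (by norm_num) (by norm_num)), one _ (by linarith) (U 4 5 (by norm_num) (by norm_num) (by norm_num)),
    one _ (by linarith) (U 4 6 (by norm_num) (by norm_num) (by norm_num)), one _ (by linarith) (U 5 6 (by norm_num) (by norm_num) (by norm_num))]
  norm_num

/-- **The Lemma-D bonus on this profile, general `b`**: `v_p(Cas_j(b)) ≥ −10 = casLB + 1` for every sorted `b` in the polytope, every admissible `j`, every
first-period prime `p ≥ 5` with `b₀ + 2 < p²` on the profile (least multipole exponent `−7`, one live deep type up to conjugation; fallback THEOREM LB). -/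
theorem cas_ge18b_neg10 (hb : InPolytope b) (hs : Sorted7 b) (hbj : InPolytope (shift b j)) (hj1 : 1 ≤ j) (hj7 : j ≤ 7)
    (hprime : p.Prime) (hp5 : 5 ≤ p) (hwin : (b 0 + 2 : ℤ) < (p : ℤ) ^ 2) (hP : (p : ℤ) ≤ b 7) (hQ : b 0 < (p : ℤ) + b 2 + b 3)
    (hQ4 : (p : ℤ) + b 1 + b 4 ≤ b 0) (hF1 : b 1 < 2 * (p : ℤ)) (hF2 : b 0 < 2 * (p : ℤ) + b 6 + b 7)
    (hcas : casoratian b j ≠ 0) : (-10 : ℤ) ≤ padicValRat p (casoratian b j) := by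
  haveI : Fact p.Prime := ⟨hprime⟩
  have hp2 : p % 2 = 1 := Nat.odd_iff.1 (hprime.odd_of_ne_two (by omega))
  obtain ⟨h0, hb1, hb2, hb3, hb4, -, -, -, -⟩ := box hb
  have hpd : (p : ℤ) ≤ dOf b := le_of_lt (d_bounds18b hs hP hQ hQ4 hF1 hF2).1
  have hpb : (p : ℤ) ≤ b 0 := by linarith
  rcases Int.emod_two_eq_zero_or_one (b 0) with hr | hr
  · obtain ⟨h1, h2, h3⟩ := checkJ18b_ev
    exact cover_J_j hb hj1 hj7 hbj hprime hp5 hpb hpd hwin (cover18b_ev hb hs hP hQ hQ4 hF1 hF2 hp5 hp2 hr)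
      (by rw [oddFlag_false hr]; exact h1) (by norm_num) (by rw [oddFlag_false hr]; exact h2) (by rw [oddFlag_false hr]; exact h3)
      (by norm_num) (by norm_num) (by norm_num) (by norm_num) hcas
  · obtain ⟨h1, h2, h3⟩ := checkJ18b_od
    exact cover_J_j hb hj1 hj7 hbj hprime hp5 hpb hpd hwin (cover18b_od hb hs hP hQ hQ4 hF1 hF2 hp5 hp2 hr)
      (by rw [oddFlag_true hr]; exact h1) (by norm_num) (by rw [oddFlag_true hr]; exact h2) (by rw [oddFlag_true hr]; exact h3)
      (by norm_num) (by norm_num) (by norm_num) (by norm_num) hcas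

end Bounds

/-! ## §3 PATH accounting below `d = 3p` and (CV) on the whole profile -/

/-- **`PathAccountingFirstPeriod`'s conclusion on this `N_p = 18` profile below `d = 3p`, EVERY sorted `b`, every direction `j`**. -/
theorem pathAccounting_profile18b (b : ℕ → ℤ) (j p : ℕ) (hb : InPolytope b) (hs : Sorted7 b) (hbj : InPolytope (shift b j))
    (hj1 : 1 ≤ j) (hj7 : j ≤ 7) (hprime : p.Prime) (hp5 : 5 ≤ p) (hwin : (b 0 + 2 : ℤ) < (p : ℤ) ^ 2) (hfp : FirstPeriod b p)
    (hP : (p : ℤ) ≤ b 7) (hQ : b 0 < (p : ℤ) + b 2 + b 3) (hQ4 : (p : ℤ) + b 1 + b 4 ≤ b 0) (hd3 : dOf b < 3 * (p : ℤ))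
    (hcas : casoratian b j ≠ 0) :
    dOf b / (p : ℤ) - pairFloors b p - min (if 2 ≤ dOf b / (p : ℤ) then (1 : ℤ) else 0) (5 - (cStar b p : ℤ))
      ≤ padicValRat p (casoratian b j) := by
  obtain ⟨hF1, hF2⟩ := fp_bounds hfp
  have hp0 : (0 : ℤ) < p := by exact_mod_cast hprime.pos
  rw [pairFloors_eq_18b hb hs hprime.pos hQ hQ4 hfp]
  have hC11 : (cStar b p : ℤ) ≤ 11 := by exact_mod_cast cStar_le_eleven b p
  have hmin : -6 ≤ min (if 2 ≤ dOf b / (p : ℤ) then (1 : ℤ) else 0) (5 - (cStar b p : ℤ)) :=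
    le_min (by split_ifs <;> norm_num) (by linarith)
  have hfd3 : dOf b / (p : ℤ) < 3 := by rw [Int.ediv_lt_iff_lt_mul hp0]; linarith
  linarith [cas_ge18b_neg10 hb hs hbj hj1 hj7 hprime hp5 hwin hP hQ hQ4 hF1 hF2 hcas]

/-- **THE NODE ON THIS `N_p = 18` PROFILE BELOW `d = 3p`, EVERY SORTED `b`: `PathAccountingFirstPeriod` with its binders VERBATIM plus `p ≤ b₇`,
`b₀ < p + b₂ + b₃`, `p + b₁ + b₄ ≤ b₀` and `d(b) < 3p`. -/
theorem pathAccountingFirstPeriod_profile18b :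
    ∀ (b : ℕ → ℤ) (p : ℕ), InPolytope b → Sorted7 b → InPolytope (shift b 7) →
      p.Prime → 5 ≤ p → (b 0 + 2 : ℤ) < (p : ℤ) ^ 2 → FirstPeriod b p →
      (p : ℤ) ≤ b 7 → b 0 < (p : ℤ) + b 2 + b 3 → (p : ℤ) + b 1 + b 4 ≤ b 0 → dOf b < 3 * (p : ℤ) → casoratian b 7 ≠ 0 →
        dOf b / (p : ℤ) - pairFloors b p - min (if 2 ≤ dOf b / (p : ℤ) then (1 : ℤ) else 0) (5 - (cStar b p : ℤ))
          ≤ padicValRat p (casoratian b 7) :=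
  fun b p hb hs hb7 hprime hp5 hwin hfp hP hQ hQ4 hd3 hcas =>
    pathAccounting_profile18b b 7 p hb hs hb7 (by norm_num) (by norm_num) hprime hp5 hwin hfp hP hQ hQ4 hd3 hcas

/-- **(CV) on the WHOLE profile, every sorted `b`, every `j`** (no hypothesis on `d`: `refund − N_p ≤ −17 ≤ −10`). -/
theorem profile18bCV (b : ℕ → ℤ) (j p : ℕ) (hb : InPolytope b) (hs : Sorted7 b) (hbj : InPolytope (shift b j))
    (hj1 : 1 ≤ j) (hj7 : j ≤ 7) (hprime : p.Prime) (hp5 : 5 ≤ p) (hwin : (b 0 + 2 : ℤ) < (p : ℤ) ^ 2) (hfp : FirstPeriod b p)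
    (hP : (p : ℤ) ≤ b 7) (hQ : b 0 < (p : ℤ) + b 2 + b 3) (hQ4 : (p : ℤ) + b 1 + b 4 ≤ b 0)
    (hcas : casoratian b j ≠ 0) : refund b p - pairFloors b p ≤ padicValRat p (casoratian b j) := by
  obtain ⟨hF1, hF2⟩ := fp_bounds hfp
  rw [pairFloors_eq_18b hb hs hprime.pos hQ hQ4 hfp]
  have hr : refund b p ≤ 1 := min_le_left _ _
  linarith [cas_ge18b_neg10 hb hs hbj hj1 hj7 hprime hp5 hwin hP hQ hQ4 hF1 hF2 hcas]

end Summit.KontsevichZagierPeriods.Zeta5Search.FullProfile
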